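import Literature.NumberTheory.Automorphic.ShimuraCurveRibetTakahashiPairwiseEisensteinProofs
import Literature.NumberTheory.EllipticCurves.EisensteinCongruenceRationalTorsionProofs
import Literature.NumberTheory.EllipticCurves.KatzPrimePowerEisensteinTorsionProofs
import HarnessLib

/-!
# Pasten's two-prime package: Lemma 6.14 at EVERY prime from Mazur's TORSION theorem
# (Katz 1981, Thms. 1–2), and the re-assembly of `PastenShimura2024_pairwise_denominator`

Topic `Literature/NumberTheory/Automorphic`; theorems only (no definition, no named fact).
Fifth reduction file for the named fact
`Literature.NumberTheory.Automorphic.PastenShimura2024_pairwise_denominator`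
(`ShimuraCurveRibetTakahashi.lean`), after `…PairwiseDenominatorProofs` (Pasten's own assembly),
`…PairwiseNoJLProofs` (no Jacquet–Langlands), `…PairwiseTakahashiProofs` (Takahashi–Brandt
coordinates), `…PairwiseEisensteinProofs` (Ribet's Eisenstein theorem proved as Brandt-matrix
algebra; Lemma 6.7 above `163` from Mazur's isogeny theorem).

## What is new

The small-prime input of Lemma 6.14 ("Pasten's Lemma 6.7 at the primes `ℓ ≤ 163`", `h67small` of
the previous file; printed proof: Faltings' theorem on the modular curves `Y_H`, Lemmas 6.4–6.6)
DISAPPEARS, and Mazur's ISOGENY theorem (`mazur_isogeny_irreducible`, used there for `ℓ > 163`) is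
replaced by Mazur's TORSION theorem (tree named fact
`Literature.NumberTheory.EllipticCurves.mazur_torsion`, Mazur 1977 Thm. (8)) at EVERY prime `ℓ`,
through the theorems of Katz (1981), both PROVED in the tree: Thm. 2 at `m = ℓ`
(`Literature.NumberTheory.EllipticCurves.EisensteinCongruenceRationalTorsionProofs`: if
`a_r(A) ≡ r + 1 (mod ℓ)` for all good `r ≠ ℓ` then some curve `ℓ`-isogenous to `A` has a rational
point of order `ℓ` — impossible for `ℓ ≥ 11`), and Thm. 1 (the lattice theorem,
`Literature.NumberTheory.GaloisRepresentations.KatzDetCongruenceLattice`) with its prime-power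
elliptic-curve form (`Literature.NumberTheory.EllipticCurves.KatzPrimePowerEisensteinTorsionProofs`:
if `a_r(A) ≡ r + 1 (mod ℓⁿ)` for almost all good `r` then isogenous curves carry rational points of
orders `ℓᵃ`, `ℓᵇ`, `a + b = n`, so `ℓⁿ ≤ 144` by Mazur — whence `β(ℓ) = 8` works at
`ℓ ∈ {2, 3, 5, 7}`). Hence the constant `κ_S` of Lemma 6.14 exists for EVERY elliptic curve over
`ℚ` (no semi-stability), supported on `{2, 3, 5, 7}`, granted `mazur_torsion` alone.

* `exists_dvd_of_eisenstein12_of_not_exists_addOrderOf` — **Lemma 6.14 (pointwise, factor `12`)**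
  from: no elliptic curve over `ℚ` has a rational point of prime order `ℓ ≥ 11`, and Lemma 6.7 at
  `ℓ ≤ 7` in the weak form "one good prime" (`h67tiny`, kept as a hypothesis in this general
  statement); `lemma_6_7_of_mazurTorsion` — **`h67tiny` (indeed Lemma 6.7 at every prime, with
  `β = 8`) from `mazur_torsion`**; `exists_dvd_of_eisenstein12_of_mazurTorsion` — Lemma 6.14 from
  `mazur_torsion` ALONE; `exists_dvd_of_eisenstein12_of_mazurLeaves` (fed by the printed leaves
  `Mazur1977_no_prime_torsion`, `MazurTate1973_no_torsion_thirteen`, and `h67tiny`).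
* `PastenShimura2024_pairwise_denominator_of_brandtDictionary_of_mazurTorsion_of_level /
  _of_carayol / _of_oggSaito` — **the fact from**: the `D = 1` character-group dictionary `hDict`
  and Takahashi's Shimura-side formula `hT2` (verbatim the hypotheses of the previous file), and
  the named facts `mazur_torsion`, `mazurKenku_exists_cyclic_isogeny` (Lemma 6.8) and the level
  input (explicit / Carayol / Ogg–Saito).

So, over the tree, `PastenShimura2024_pairwise_denominator` now follows from the named facts
`mazur_torsion`, `mazurKenku_exists_cyclic_isogeny`, the Ogg–Saito schema, and TWO printed
theorems with no declaration in the tree: `hDict` (Ribet 1990 Prop. 3.1 / Takahashi 2001 §2, p. 84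
at `r ∥ N`) and `hT2` (Takahashi 2001 Thm. 2.3 at `p ∣ D` with Thm. 3.2 (a)).

## References

* [PastenShimura2024] H. Pasten, *Shimura curves and the abc conjecture*, J. Number Theory 254
  (2024) = arXiv:1705.09251: Lemma 6.3 p. 21, Lemma 6.7 p. 22, Lemma 6.14 p. 23, §6.9 p. 25 (read).
* [Katz1980] N. M. Katz, *Galois properties of torsion points on abelian varieties*, Invent. Math.
  62 (1981), Thms. 1, 2; [CullinanKenneyVoight2022] J. Cullinan, M. Kenney, J. Voight, J. Théor.
  Nombres Bordeaux 34 (2022), Thm. 2.3.1, Cor. 2.3.6 (read).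
* [Mazur1977] B. Mazur, Publ. Math. IHÉS 47 (1977), Thm. (8); [MazurTate1973]; [Mazur1978] Thm. 1.
* [Takahashi2001] S. Takahashi, J. Number Theory 90 (2001), Thm. 2.3, Prop. 3.1, Thm. 3.2 (a).
-/

noncomputable section

open scoped MatrixGroups ModularForm
open _root_.MeasureTheory UpperHalfPlane CongruenceSubgroup

namespace Literature.NumberTheory.Automorphic

open Literature.NumberTheory.EllipticCurves (mazurKenku_exists_cyclic_isogeny mazur_torsion
  Mazur1977_no_prime_torsion MazurTate1973_no_torsion_thirteen
  exists_prime_not_dvd_lFunction_sub_of_not_exists_addOrderOf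
  not_exists_addOrderOf_eq_of_mazur_torsion conductorNorm_eq_of_isIsogenous_of_tate
  exists_prime_not_pow_dvd_lFunction_sub_of_mazur_torsion)
open Literature.NumberTheory.EllipticCurves.ModularForms (ModularParametrizationData IsNewformOf)

/-! ## Lemma 6.14 with the factor `12`: every prime `ℓ ≥ 11` from the absence of rational
`ℓ`-torsion -/

/-- **Pasten 2024, Lemma 6.14 (pointwise, factor `12`), its primes `ℓ ≥ 11` from Katz's theorem and
the absence of rational `ℓ`-torsion over `ℚ`.** Hypotheses: (`hno`) for every prime `ℓ ≥ 11`, no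
elliptic curve over `ℚ` has a rational point of order `ℓ` (Mazur 1977, Thm. (8)); (`h67tiny`)
Pasten's Lemma 6.7 at the primes `ℓ ≤ 7` only, weak form "one good prime": an exponent `β` such
that every `A/ℚ` semistable away from `S` has a prime `r ∤ N_A` with `ℓ^β ∤ r + 1 − a_r(A)`.
Conclusion: one integer `κ₁ ≥ 1` supported on primes `≤ 7` such that for every `A/ℚ` of conductor
`N` squarefree away from `S` and every `i ≥ 1` with `i ∣ 12 (r + 1 − a_r(A))` for all primes
`r ∤ N`: `i ∣ κ₁`. Proof prime by prime as printed (p. 23): for `ℓ ≤ 7`,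
`v_ℓ(i) ≤ v_ℓ(12) + β − 1`; for `ℓ ≥ 11`, some good `r ≠ ℓ`, `r ∤ N_A`, has `a_r(A) ≢ r + 1 (mod ℓ)` —
otherwise a curve `ℓ`-isogenous to `A` has a rational point of order `ℓ` (Katz 1981 Thm. 2 at
`m = ℓ`, tree theorem `exists_prime_not_dvd_lFunction_sub_of_not_exists_addOrderOf`) — whence
`ℓ ∤ i`; `κ₁ = 12 ∏_{ℓ ≤ 7} ℓ^{β_ℓ − 1}`. [cite: PastenShimura2024, Lemma 6.14 p. 23 (proof), Lemma 6.7 p. 22] [cite: Katz1980, Thm. 2 (m = ℓ)] [cite: Mazur1977, Thm. (8)] -/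
theorem exists_dvd_of_eisenstein12_of_not_exists_addOrderOf {S : Finset ℕ}
    (hno : ∀ ℓ : ℕ, ℓ.Prime → 11 ≤ ℓ → ∀ (V : WeierstrassCurve ℚ) [V.IsElliptic],
      ¬ ∃ Q : V.toAffine.Point, addOrderOf Q = ℓ)
    (h67tiny : ∀ ℓ : ℕ, ℓ.Prime → ℓ ≤ 7 → ∃ β : ℕ,
      ∀ (A : WeierstrassCurve ℚ) [A.IsElliptic],
        (∀ q : ℕ, q.Prime → q ∉ S → ¬ q ^ 2 ∣ A.conductorNorm ℤ) →
        ∃ r : ℕ, r.Prime ∧ ¬ r ∣ A.conductorNorm ℤ ∧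
          ¬ ((ℓ ^ β : ℕ) : ℤ) ∣ (r + 1 : ℤ) - A.LFunction r) :
    ∃ κ₁ : ℕ, 1 ≤ κ₁ ∧ (∀ q ∈ κ₁.primeFactors, q ≤ 7) ∧
      ∀ (A : WeierstrassCurve ℚ) [A.IsElliptic] {N : ℕ}, 0 < N → A.conductorNorm ℤ = N →
        (∀ q : ℕ, q.Prime → q ∉ S → ¬ q ^ 2 ∣ N) →
        ∀ {i : ℕ}, 0 < i →
          (∀ r : ℕ, r.Prime → ¬ r ∣ N → (i : ℤ) ∣ ((12 : ℕ) : ℤ) * ((r + 1 : ℤ) - A.LFunction r)) →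
            i ∣ κ₁ := by
  classical
  choose β hβ using h67tiny
  let α : ℕ → ℕ := fun ℓ =>
    (12 : ℕ).factorization ℓ + (if h : ℓ.Prime ∧ ℓ ≤ 7 then β ℓ h.1 h.2 - 1 else 0)
  have hα : ∀ ℓ, α ℓ =
      (12 : ℕ).factorization ℓ + (if h : ℓ.Prime ∧ ℓ ≤ 7 then β ℓ h.1 h.2 - 1 else 0) :=
    fun ℓ => rfl
  have h12fac : ∀ ℓ : ℕ, 8 ≤ ℓ → (12 : ℕ).factorization ℓ = 0 := fun ℓ h8 => by
    by_cases hp : ℓ.Prime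
    · refine Nat.factorization_eq_zero_of_not_dvd fun h => ?_
      have hℓ12 := Nat.le_of_dvd (by norm_num) h
      interval_cases ℓ
      · norm_num at hp
      · norm_num at hp
      · norm_num at hp
      · norm_num at h
      · norm_num at hp
    · exact Nat.factorization_eq_zero_of_not_prime _ hp
  have hα0 : ∀ ℓ : ℕ, ℓ.Prime → 8 ≤ ℓ → α ℓ = 0 := by
    intro ℓ hℓ h8
    rw [hα, h12fac ℓ h8, dif_neg (fun h => absurd h.2 (by omega)), add_zero]
  refine ⟨∏ ℓ ∈ (Finset.range 8).filter Nat.Prime, ℓ ^ α ℓ,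
    (one_le_prod_pow_and_primeFactors_lt 8 α).1,
    fun q hq => Nat.lt_succ_iff.mp ((one_le_prod_pow_and_primeFactors_lt 8 α).2 q hq), ?_⟩
  intro A _ N hN hAN hS i hi hEis
  refine dvd_prod_pow_of_factorization_le hi.ne' (fun ℓ hℓ => ?_) hα0
  have hℓZ : Prime (ℓ : ℤ) := Nat.prime_iff_prime_int.mp hℓ
  by_cases h7 : ℓ ≤ 7
  · -- small primes: `v_ℓ(i) ≤ v_ℓ(12) + β − 1` from one good prime `r`
    obtain ⟨r, hr, hrN, hndvd⟩ := hβ ℓ hℓ h7 A (fun q hq hqS => by rw [hAN]; exact hS q hq hqS)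
    have hrN' : ¬ r ∣ N := fun h => hrN (by rw [hAN]; exact h)
    have hdvd := hEis r hr hrN'
    set m : ℤ := (r + 1 : ℤ) - A.LFunction r with hm
    have hm0 : m ≠ 0 := fun h0 => hndvd (by rw [h0]; exact dvd_zero _)
    have hmabs : m.natAbs ≠ 0 := Int.natAbs_ne_zero.mpr hm0
    -- `i ∣ 12 |m|` in `ℕ`
    have hdvdN : i ∣ 12 * m.natAbs := by
      have h1 : ((i : ℤ)).natAbs ∣ ((12 : ℤ) * m).natAbs :=
        Int.natAbs_dvd_natAbs.mpr (by exact_mod_cast hdvd)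
      simpa [Int.natAbs_mul] using h1
    have h12 : (12 : ℕ) ≠ 0 := by norm_num
    have hfac : i.factorization ℓ ≤ (12 : ℕ).factorization ℓ + (m.natAbs).factorization ℓ := by
      have h := (Nat.factorization_le_iff_dvd hi.ne' (mul_ne_zero h12 hmabs)).mpr hdvdN ℓ
      rwa [Nat.factorization_mul h12 hmabs, Finsupp.add_apply] at h
    -- `v_ℓ(|m|) < β`
    have hlt : (m.natAbs).factorization ℓ < β ℓ hℓ h7 := by
      by_contra hge
      push Not at hge
      apply hndvd
      have h1 : ℓ ^ β ℓ hℓ h7 ∣ m.natAbs :=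
        (pow_dvd_pow ℓ hge).trans (Nat.ordProj_dvd _ ℓ)
      exact Int.natAbs_dvd_natAbs.mp (by simpa using h1)
    rw [hα, dif_pos ⟨hℓ, h7⟩]
    omega
  · -- primes `ℓ ≥ 11`: `ℓ ∤ i` by Katz's theorem and the absence of rational `ℓ`-torsion
    push Not at h7
    have h11 : 11 ≤ ℓ := by
      by_contra hlt
      push Not at hlt
      interval_cases ℓ <;> exact absurd hℓ (by norm_num)
    haveI : Fact ℓ.Prime := ⟨hℓ⟩
    obtain ⟨r, hr, -, hrN, hne⟩ :=
      exists_prime_not_dvd_lFunction_sub_of_not_exists_addOrderOf A ℓ (fun V _ => hno ℓ hℓ h11 V)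
    have hrN' : ¬ r ∣ N := fun h => hrN (by rw [hAN]; exact h)
    have hdvd := hEis r hr hrN'
    have hℓi : ¬ ℓ ∣ i := by
      intro hℓi
      have h1 : (ℓ : ℤ) ∣ ((12 : ℕ) : ℤ) * ((r + 1 : ℤ) - A.LFunction r) :=
        (Int.natCast_dvd_natCast.mpr hℓi).trans hdvd
      rcases hℓZ.dvd_or_dvd h1 with h2 | h2
      · have h3 : ℓ ∣ 12 := Int.natCast_dvd_natCast.mp h2
        have := Nat.le_of_dvd (by norm_num) h3
        interval_cases ℓ
        · norm_num at h3
        · norm_num at hℓ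
      · apply hne
        have e : A.LFunction r - (r + 1 : ℤ) = -((r + 1 : ℤ) - A.LFunction r) := by ring
        rw [e]
        exact dvd_neg.mpr h2
    rw [Nat.factorization_eq_zero_of_not_dvd hℓi]
    exact Nat.zero_le _

/-- **Pasten 2024, Lemma 6.7 with `β = 8` at every prime, from Mazur's TORSION theorem and
Katz's theorem at level `ℓ⁸`** (`exists_prime_not_pow_dvd_lFunction_sub_of_mazur_torsion`:
`ℓ⁸ ≥ 256 > 144`): for every `A/ℚ` a prime `r ∤ N_A` with `ℓ⁸ ∤ r + 1 − a_r(A)`. In particular the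
input `h67tiny` of `exists_dvd_of_eisenstein12_of_not_exists_addOrderOf`.
[cite: PastenShimura2024, Lemma 6.7 p. 22] [cite: Katz1980, Thms. 1, 2] [cite: Mazur1977, Thm. (8)] -/
theorem lemma_6_7_of_mazurTorsion (hMT : ∀ V : WeierstrassCurve ℚ, mazur_torsion V)
    (S : Finset ℕ) (ℓ : ℕ) (hℓ : ℓ.Prime) :
    ∃ β : ℕ, ∀ (A : WeierstrassCurve ℚ) [A.IsElliptic],
      (∀ q : ℕ, q.Prime → q ∉ S → ¬ q ^ 2 ∣ A.conductorNorm ℤ) →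
      ∃ r : ℕ, r.Prime ∧ ¬ r ∣ A.conductorNorm ℤ ∧
        ¬ ((ℓ ^ β : ℕ) : ℤ) ∣ (r + 1 : ℤ) - A.LFunction r := by
  refine ⟨8, fun A _ _ => ?_⟩
  haveI : Fact ℓ.Prime := ⟨hℓ⟩
  have hn : 144 < ℓ ^ 8 := lt_of_lt_of_le (by norm_num) (Nat.pow_le_pow_left hℓ.two_le 8)
  obtain ⟨r, hr, -, -, hrN, hne⟩ :=
    exists_prime_not_pow_dvd_lFunction_sub_of_mazur_torsion hMT A ℓ hn ∅ Set.finite_empty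
  refine ⟨r, hr, hrN, fun h => hne ?_⟩
  have e : A.LFunction r - (r + 1 : ℤ) = -((r + 1 : ℤ) - A.LFunction r) := by ring
  rw [e]
  exact dvd_neg.mpr h

/-- **Lemma 6.14 (pointwise, factor `12`) from Mazur's torsion theorem ALONE** (tree named fact
`mazur_torsion`: no rational point of prime order `ℓ ≥ 11`, `not_exists_addOrderOf_eq_of_mazur_torsion`;
and Lemma 6.7 at `ℓ ≤ 7` by `lemma_6_7_of_mazurTorsion`).
[cite: PastenShimura2024, Lemma 6.14 p. 23] [cite: Mazur1977, Thm. (8)] [cite: Katz1980, Thms. 1, 2] -/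
theorem exists_dvd_of_eisenstein12_of_mazurTorsion {S : Finset ℕ}
    (hMT : ∀ V : WeierstrassCurve ℚ, mazur_torsion V) :
    ∃ κ₁ : ℕ, 1 ≤ κ₁ ∧ (∀ q ∈ κ₁.primeFactors, q ≤ 7) ∧
      ∀ (A : WeierstrassCurve ℚ) [A.IsElliptic] {N : ℕ}, 0 < N → A.conductorNorm ℤ = N →
        (∀ q : ℕ, q.Prime → q ∉ S → ¬ q ^ 2 ∣ N) →
        ∀ {i : ℕ}, 0 < i →
          (∀ r : ℕ, r.Prime → ¬ r ∣ N → (i : ℤ) ∣ ((12 : ℕ) : ℤ) * ((r + 1 : ℤ) - A.LFunction r)) →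
            i ∣ κ₁ :=
  exists_dvd_of_eisenstein12_of_not_exists_addOrderOf
    (fun _ hℓ h11 V _ => not_exists_addOrderOf_eq_of_mazur_torsion V (hMT V) hℓ h11)
    fun ℓ hℓ _ => lemma_6_7_of_mazurTorsion hMT S ℓ hℓ

/-- **Lemma 6.14 (pointwise, factor `12`) from the printed leaves of Mazur's theorem**
(`Mazur1977_no_prime_torsion`: no rational point of prime order `N ∉ {2, 3, 5, 7, 13}`, Mazur 1977
Ch. III §5; `MazurTate1973_no_torsion_thirteen` for `13`) and `h67tiny`.
[cite: PastenShimura2024, Lemma 6.14 p. 23] [cite: Mazur1977, Ch. III §5, pp. 156–160] -/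
theorem exists_dvd_of_eisenstein12_of_mazurLeaves {S : Finset ℕ}
    (h5 : ∀ V : WeierstrassCurve ℚ, Mazur1977_no_prime_torsion V)
    (h13 : ∀ V : WeierstrassCurve ℚ, MazurTate1973_no_torsion_thirteen V)
    (h67tiny : ∀ ℓ : ℕ, ℓ.Prime → ℓ ≤ 7 → ∃ β : ℕ,
      ∀ (A : WeierstrassCurve ℚ) [A.IsElliptic],
        (∀ q : ℕ, q.Prime → q ∉ S → ¬ q ^ 2 ∣ A.conductorNorm ℤ) →
        ∃ r : ℕ, r.Prime ∧ ¬ r ∣ A.conductorNorm ℤ ∧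
          ¬ ((ℓ ^ β : ℕ) : ℤ) ∣ (r + 1 : ℤ) - A.LFunction r) :
    ∃ κ₁ : ℕ, 1 ≤ κ₁ ∧ (∀ q ∈ κ₁.primeFactors, q ≤ 7) ∧
      ∀ (A : WeierstrassCurve ℚ) [A.IsElliptic] {N : ℕ}, 0 < N → A.conductorNorm ℤ = N →
        (∀ q : ℕ, q.Prime → q ∉ S → ¬ q ^ 2 ∣ N) →
        ∀ {i : ℕ}, 0 < i →
          (∀ r : ℕ, r.Prime → ¬ r ∣ N → (i : ℤ) ∣ ((12 : ℕ) : ℤ) * ((r + 1 : ℤ) - A.LFunction r)) →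
            i ∣ κ₁ := by
  refine exists_dvd_of_eisenstein12_of_not_exists_addOrderOf (fun ℓ hℓ h11 V _ => ?_) h67tiny
  by_cases hℓ13 : ℓ = 13
  · subst hℓ13
    exact h13 V
  · refine h5 V ℓ hℓ ?_
    simp only [Finset.mem_insert, Finset.mem_singleton, not_or]
    omega

/-! ## The two-prime package from the dictionary, Takahashi's Shimura-side formula, Mazur's
torsion theorem and Mazur–Kenku -/

section Final

variable
  /- (`hDict`) the `D = 1` character-group dictionary at a prime `r ∥ N` — verbatim the `hDict` of
  `ShimuraCurveRibetTakahashiPairwiseEisensteinProofs.lean` (see there). -/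
  (hDict : ∀ (W : WeierstrassCurve ℚ) [W.IsElliptic] (M r : ℕ) [NeZero (M * r)],
    r.Prime → M.Coprime r → W.conductorNorm ℤ = M * r →
    ∀ P : ModularParametrizationData W (M * r),
      (∀ (W' : WeierstrassCurve ℚ) [W'.IsElliptic], W'.conductorNorm ℤ = M * r →
          ∀ P' : ModularParametrizationData W' (M * r),
          P'.f = P.f → P.modularDegree ≤ P'.modularDegree) →
      ∀ (S : Brandt.XiSetup M r) [Fintype (Brandt.ClassSet S.O)],
        ∃ (X : Submodule ℤ (Brandt.ClassSet S.O → ℤ)) (pb : ℤ →ₗ[ℤ] X) (pf : X →ₗ[ℤ] ℤ),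
          (∀ (a : ℤ) (y : X),
              ∑ i, (Brandt.weight S.O i : ℤ) * (pb a : Brandt.ClassSet S.O → ℤ) i *
                  (y : Brandt.ClassSet S.O → ℤ) i =
                ((W.minimalDiscriminantNorm ℤ).factorization r : ℤ) * a * pf y) ∧
          (∀ a : ℤ, pf (pb a) = (P.modularDegree : ℤ) * a) ∧
          Function.Surjective pf ∧
          (∀ (m : ℤ) (v : Brandt.ClassSet S.O → ℤ), m ≠ 0 → m • v ∈ X → v ∈ X) ∧
          (∀ v : Brandt.ClassSet S.O → ℤ, ∑ i, v i = 0 → v ∈ X) ∧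
          Module.finrank ℤ
              (Brandt.eigenLattice (M * r) (Brandt.matrix S.O) (fun n => W.LFunction n)) = 1 ∧
          (pb 1 : Brandt.ClassSet S.O → ℤ) ∈
            Brandt.eigenLattice (M * r) (Brandt.matrix S.O) (fun n => W.LFunction n))
  /- (`hT2`) Takahashi 2001, Thm. 2.3 for `X₀^D(M)` at `p ∣ D` with Thm. 3.2 (a) — verbatim the `hT2`
  of the sibling files. -/
  (hT2 : ∀ {N D M p d : ℕ}, p.Prime → D = p * d → IsAdmissibleFactorization N D M →
    ∀ (X : ShimuraCurveData D M) (W : WeierstrassCurve ℚ) [W.IsElliptic],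
      W.conductorNorm ℤ = N →
    ∀ (W' : WeierstrassCurve ℚ) [W'.IsElliptic] (P : ShimuraParametrizationData X W'),
      P.IsMinimalFor W →
    ∀ S : Brandt.XiSetup (p * M) d,
      ∃ i j : ℕ, 0 < i ∧ i * j = (W'.minimalDiscriminantNorm ℤ).factorization p ∧
        i ∣ S.xi (fun n => W'.LFunction n) ∧
        P.deg * i = S.xi (fun n => W'.LFunction n) * j)

include hDict hT2 in
/-- **Pasten 2024, the pairwise `gcd`-bounded denominator of `γ_{pq,M,E}`, from the `D = 1`
character-group dictionary, Takahashi's Shimura-side formula, Mazur's TORSION theorem and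
Mazur–Kenku — level input explicit.** As
`PastenShimura2024_pairwise_denominator_of_brandtDictionary_of_level` (previous file), with its
Lemma 6.14 package now `exists_dvd_of_eisenstein12_of_mazurTorsion`: ALL the primes of
Lemma 6.14 come from `mazur_torsion` through Katz's theorems (no `h67small`, no
`mazur_isogeny_irreducible`).
[cite: PastenShimura2024, §6.9 (EqSequentially) p. 25 with d = 1, Lemma 6.14 p. 23, Lemma 6.8 p. 22] [cite: Mazur1977, Thm. (8)] [cite: Katz1980, Thm. 2 (m = ℓ)] -/
theorem PastenShimura2024_pairwise_denominator_of_brandtDictionary_of_mazurTorsion_of_level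
    (hMT : ∀ V : WeierstrassCurve ℚ, mazur_torsion V) (hMK : mazurKenku_exists_cyclic_isogeny)
    (hlev : ∀ {N : ℕ} [NeZero N] {W₁ : WeierstrassCurve ℚ} [W₁.IsElliptic]
      (D₁ : ModularParametrizationData W₁ N) (W : WeierstrassCurve ℚ) [W.IsElliptic],
      IsNewformOf W D₁.f → W.conductorNorm ℤ = N → W₁.conductorNorm ℤ = N) :
    PastenShimura2024_pairwise_denominator :=
  PastenShimura2024_pairwise_denominator_of_imageCokernel_package hT2 12 hMK
    (fun {_} _ W _ {_ _} hN hr hMr hW P hmin S =>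
      imageCokernel_package_of_brandtDictionary hDict W hN hr hMr hW P hmin S)
    (fun S => by
      obtain ⟨κ₁, h1, h7, h⟩ := exists_dvd_of_eisenstein12_of_mazurTorsion (S := S) hMT
      exact ⟨κ₁, h1, fun q hq => (h7 q hq).trans (by norm_num), h⟩)
    hlev

include hDict hT2 in
/-- **The same, level input from Carayol's theorem** (`IsNewformOf.level_eq_conductorNorm`, tree
fact). [cite: PastenShimura2024, §6.9 (EqSequentially) p. 25 with d = 1] [cite: Carayol1986] -/
theorem PastenShimura2024_pairwise_denominator_of_brandtDictionary_of_mazurTorsion_of_carayol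
    (hMT : ∀ V : WeierstrassCurve ℚ, mazur_torsion V) (hMK : mazurKenku_exists_cyclic_isogeny)
    (hCar : ∀ {N : ℕ} [NeZero N], IsNewformOf.level_eq_conductorNorm (N := N)) :
    PastenShimura2024_pairwise_denominator :=
  PastenShimura2024_pairwise_denominator_of_brandtDictionary_of_mazurTorsion_of_level hDict hT2
    hMT hMK fun D₁ _ _ _ _ => (hCar D₁.isNewformOf).symm

include hDict hT2 in
/-- **The same, level input from Ogg–Saito** (the conductor is an isogeny invariant granted the
tree's schema `artinConductorExponent_tate_eq_conductorExponent_of_isElliptic`; `W₁ ∼ W` by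
Faltings, `isIsogenous_of_lFunction_prime_eq_of_not_dvd`). So, over the tree,
`PastenShimura2024_pairwise_denominator` follows from: the named facts `mazur_torsion`,
`mazurKenku_exists_cyclic_isogeny`, the Ogg–Saito schema; the `D = 1` character-group dictionary
`hDict`; and `hT2` (Takahashi 2001, Thm. 2.3 at `p ∣ D` with Thm. 3.2 (a)). [cite: PastenShimura2024, §6.9 (EqSequentially) p. 25 with d = 1] [cite: SilvermanATAEC1994, Exercise 4.40 with §IV.10] -/
theorem PastenShimura2024_pairwise_denominator_of_brandtDictionary_of_mazurTorsion_of_oggSaito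
    (hMT : ∀ V : WeierstrassCurve ℚ, mazur_torsion V) (hMK : mazurKenku_exists_cyclic_isogeny)
    (hOS : ∀ (W : WeierstrassCurve ℚ) (ℓ : ℕ) [Fact ℓ.Prime],
      W.artinConductorExponent_tate_eq_conductorExponent_of_isElliptic ℓ) :
    PastenShimura2024_pairwise_denominator :=
  PastenShimura2024_pairwise_denominator_of_brandtDictionary_of_mazurTorsion_of_level hDict hT2
    hMT hMK fun D₁ W _ hf hWN => by
      have hiso := isIsogenous_of_lFunction_prime_eq_of_not_dvd (N₀ := 1) one_ne_zero
        fun ℓ _ _ => by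
          have h := (D₁.isNewformOf.2 ℓ).symm.trans (hf.2 ℓ)
          exact_mod_cast h
      exact (conductorNorm_eq_of_isIsogenous_of_tate hOS _ _ hiso).trans hWN

end Final

end Literature.NumberTheory.Automorphic

end
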